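import Summits.HubbardSuperconductivity.HubbardSuperconductivity.Theorems.AnisotropyChordTransferFibre3FinX3Eval

/-!
# Route `AnisotropyChord` / H0 rotor rung: FIN per-`L` GM₃ (X5), `L = 29` — rows `N₁` / D / side-condition cell facts, part `p04`

Kernel facts (`decide +kernel`) for cert cells 28, 29 of the per-`L` grid of `L = 29`: `xbnCellAny2` (row `N₁` on XB2 point wedges recomputed in the kernel, exporting the literal brackets `nt ⊇ T⁺ − 3λ₂` and `tb ⊇ T⁺·D`), `xdCellAnyN0` (row D, reads `nt`), `sdCellAnyZN` (side condition, reads `nt`); evaluators `…FinX3Eval` / `…FinX5Eval`; constants from the compiled design probe (x3probe/x3plan, margins c ×0.985, b ×1.03, aD ×1.03); assembled in `…FinX5GM3TwentyNine`.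
Prover seat `hubbard-h0-rotor-p3` g8; helper for piece A = stmt-HubbardSuperconductivity-23918 of rung 19089 (`--supports`, helper class).
WHAT THIS IS NOT: nothing here proves superconductivity in the Hubbard model (rotor TARGET as worded stays FALSE, g15 verdict); kernel facts for the FIN certificate of ONE conditional reduction.  Tree imports only; zero data; standard axioms.
-/

set_option linter.dupNamespace false
set_option autoImplicit false

namespace Summit.HubbardSuperconductivity.HubbardSuperconductivity.Theorems.AnisotropyChord.Transfer.Fibre3

namespace FinXD

open FinXB FinCell Hole2

set_option maxHeartbeats 4000000 in
/-- row `N₁` of cell 28 of `L = 29` (`c = 119/200`), exporting `nt`, `tb`. [folklore] -/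
theorem xn29_28 : xbnCellAny2 29 (49/50 : ℚ) 123851928191965 126948226396765 (119/200 : ℚ) ((-2371216176539 : ℤ), (2328407260251 : ℤ)) ((369182300602819 : ℤ), (383175354247083 : ℤ)) = true := by decide +kernel

set_option maxHeartbeats 4000000 in
/-- row D of cell 28 of `L = 29` (`aD = 17/200`). [folklore] -/
theorem xd29_28 : xdCellAnyN0 29 (49/50 : ℚ) 123851928191965 126948226396765 (17/200 : ℚ) ((-2371216176539 : ℤ), (2328407260251 : ℤ)) = true := by decide +kernel

set_option maxHeartbeats 4000000 in
/-- side condition of cell 28 of `L = 29` (`c, b = 55/100, aD`). [folklore] -/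
theorem sd29_28 : sdCellAnyZN 29 (49/50 : ℚ) 100 123851928191965 126948226396765 ((119/200 : ℚ), (55 : ℕ), (17/200 : ℚ)) ((-2371216176539 : ℤ), (2328407260251 : ℤ)) = true := by decide +kernel

set_option maxHeartbeats 4000000 in
/-- row `N₁` of cell 29 of `L = 29` (`c = 119/200`), exporting `nt`, `tb`. [folklore] -/
theorem xn29_29 : xbnCellAny2 29 (49/50 : ℚ) 126948226396765 130121932056685 (119/200 : ℚ) ((-2363350717934 : ℤ), (2327136330861 : ℤ)) ((378479003980910 : ℤ), (392695256992367 : ℤ)) = true := by decide +kernel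

set_option maxHeartbeats 4000000 in
/-- row D of cell 29 of `L = 29` (`aD = 17/200`). [folklore] -/
theorem xd29_29 : xdCellAnyN0 29 (49/50 : ℚ) 126948226396765 130121932056685 (17/200 : ℚ) ((-2363350717934 : ℤ), (2327136330861 : ℤ)) = true := by decide +kernel

set_option maxHeartbeats 4000000 in
/-- side condition of cell 29 of `L = 29` (`c, b = 55/100, aD`). [folklore] -/
theorem sd29_29 : sdCellAnyZN 29 (49/50 : ℚ) 100 126948226396765 130121932056685 ((119/200 : ℚ), (55 : ℕ), (17/200 : ℚ)) ((-2363350717934 : ℤ), (2327136330861 : ℤ)) = true := by decide +kernel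

end FinXD

end Summit.HubbardSuperconductivity.HubbardSuperconductivity.Theorems.AnisotropyChord.Transfer.Fibre3
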